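import Mathlib
import HarnessLib
import Literature.MathematicalPhysics.StatisticalMechanics.TorusFRDStepKernelPair
import Literature.MathematicalPhysics.StatisticalMechanics.LinearisedMapABKMKernelSub
import Literature.MathematicalPhysics.StatisticalMechanics.LinearisedMapKernelSubTorusFRD
import Literature.MathematicalPhysics.StatisticalMechanics.StepOperatorBLipschitzUnifTorusFRD

/-!
# `‖C_k^{(q')}K − C_k^{(q)}K‖_{k+1}^{(A)} ≤ C·(L^d ℓ (2^dκ) c + ℓ ε)` with an `N`-FREE `ℓ` — the linear part of
# hypothesis (12.53) of [ABKM19] Lemma 12.6 for ONE `TorusFRD` package, volume-uniform form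

`LinearisedMapKernelSubTorusFRD.weakNormLE_opC_sub_of_torusFRD` supplies the pair property of Lemma 8.4 from the
GLOBAL density comparison (`gaussCompConst(|Λ|, q_H)`, exponential in the volume).  Here the pair property on
CONNECTED polymers is `tayNormLE_fluct_sub_fluct_conn_of_torusFRD` (small-torus localisation, p821855), whose
polynomial factor `(2(|X|_k + c₁))^{d/2}` is absorbed into the base `κ ↦ 2^d κ` exactly as in
`StepOperatorBLipschitzUnifTorusFRD` (`sqrt_polymerFactor_le`).  The result is the first Banach-grade
(volume-uniform) piece of the two-kernel comparison of `S_k` (the `Σ₁`/linear part):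

* **`weakNormLE_opC_sub_unif_of_torusFRD`** — `‖opC D_{q'} K − opC D_q K‖_{k+1}^{(A)} ≤
  C·(L^d·(ℓ·2^dκ)·abkmContrConst + ℓ·largePartEps(A, 2^dκ, η))`,
  `ℓ = (r₀+1)·8q_H·(3^{d+1}(2(c₁+1))^d)^{1/2}·(T e^{2KT} K)`, `T = Σ|q'−q|`, `c₁ = 2(2^d+R)+2p_Φ+1`; needs the gap
  `d + 1 ≤ 2(ñ−n)` and the large-set conditions at `2^dκ`.

Everything is proved; no named fact.

## References
* S. Adams, S. Buchholz, R. Kotecký, S. Müller, arXiv:1910.13564, Lemma 10.1, Lemma 12.6 (12.53)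
  [AdamsBuchholzKoteckyMuller2019].
* S. Buchholz, J. Funct. Anal. 275 (2018), Thm 4.5 [Buchholz2016].
-/

noncomputable section

namespace Literature.MathematicalPhysics.StatisticalMechanics.GradientRG

open scoped BigOperators
open Real Set Finset MeasureTheory
open Literature.MathematicalPhysics.StatisticalMechanics.GradientFRD
  (fourierCoeff cExt cExt_of_mem IsElliptic IsUnitSymm InShell iterDiff supNorm conv ellOp isElliptic_one
    exists_inShell re_fourierCoeff_zero_of_sum_eq_zero)
open Literature.MathematicalPhysics.StatisticalMechanics.TorusPolymer (IsPolymer numBlocks blocks blockOf boxCorner closure)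
open Literature.Barriers.CriticalPhenomena.LongRangePhi4.Polymer (IsConn)
open Literature.MathematicalPhysics.QuantumFieldTheory

variable {d M : ℕ} [NeZero M]

section Package

variable {L N Mord R n ñ : ℕ} {θbar lam μ δ₁ δ₀ A𝒫 : ℝ}
    {𝒞 : Matrix (Fin d) (Fin d) ℝ → ℕ → (Fin d → ZMod M) → ℝ} {Mc : ℕ → ℝ}
    {Cα : (Fin d → ℕ) → ℕ → ℝ} {c C : ℝ} {Cℓ : ℕ → ℝ}

/-- **The linear part of hypothesis (12.53), torus data, VOLUME-UNIFORM constant**: as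
`weakNormLE_opC_sub_of_torusFRD` but with the pair constant
`ℓ = (r₀+1)·8q_H·(3^{d+1}(2(c₁+1))^d)^{1/2}·(Σ|q'−q|·e^{2KΣ|q'−q|}·K)` (no dependence on `N`) and the base `2^dκ`
in place of `κ` (large-set conditions at `2^dκ`). [cite: AdamsBuchholzKoteckyMuller2019, Lemma 10.1 / Lemma 12.6 (12.53)] -/
theorem weakNormLE_opC_sub_unif_of_torusFRD
    (hd : 3 ≤ d) (hMord : 1 ≤ Mord) (hMR : Mord ≤ R) (hLodd : Odd L) (hL : 2 ^ (d + 3) + 16 * R ≤ L)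
    (hM : M = L ^ N)
    (hθbar : 0 < θbar) (hlam : 0 < lam) (hn : 2 * Mord ≤ n) (hn2 : 2 ≤ n) (hnñ : n ≤ ñ)
    (hgap : d + 1 ≤ 2 * (ñ - n))
    (hc : 0 < c) (hC1 : 0 ≤ Cℓ 1)
    (hallA : ∀ A : Matrix (Fin d) (Fin d) ℝ, IsElliptic (1 / 2 : ℝ) 2 A →
        (∀ k, 1 ≤ k → k ≤ N + 1 →
          ∑ x : Fin d → ZMod M, 𝒞 A k x = 0 ∧ ∀ x, 𝒞 A k (-x) = 𝒞 A k x) ∧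
        (∀ k, 1 ≤ k → k ≤ N + 1 → ∀ φ : (Fin d → ZMod M) → ℝ, ∑ x, φ x = 0 →
          0 ≤ ∑ x, ∑ y, φ x * 𝒞 A k (x - y) * φ y) ∧
        (∀ φ : (Fin d → ZMod M) → ℝ, ∑ x, φ x = 0 →
          ellOp A (conv (fun x => ∑ k ∈ Finset.Icc 1 (N + 1), 𝒞 A k x) φ) = φ) ∧
        (∀ k, 1 ≤ k → k ≤ N → Mc k ≤ 0 ∧
          ∀ x : Fin d → ZMod M, ((L : ℝ) ^ k) / 2 ≤ (supNorm x : ℝ) →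
            𝒞 A k x = Mc k) ∧
        (∀ k, 1 ≤ k → k ≤ N + 1 → ∀ B : Matrix (Fin d) (Fin d) ℝ, IsUnitSymm B →
          (∃ ε : ℝ, 0 < ε ∧ ∀ x : Fin d → ZMod M,
            ContDiffOn ℝ ⊤ (fun s : ℝ => 𝒞 (A + s • B) k x) (Set.Ioo (-ε) ε)) ∧
          ∀ α : Fin d → ℕ, ∑ i, α i ≤ n → ∀ ℓ : ℕ, ∀ x : Fin d → ZMod M,
            abs (iteratedDeriv ℓ (fun s : ℝ => iterDiff α (𝒞 (A + s • B) k) x) 0)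
              ≤ Cα α ℓ / (L : ℝ) ^ ((k - 1) * (d - 2 + ∑ i, α i))) ∧
        (∀ k, 1 ≤ k → k ≤ N + 1 → ∀ j : ℕ, ∀ κ : Fin d → ZMod M, κ ≠ 0 → InShell L j κ →
          (j < k →
            c / (L : ℝ) ^ (2 * (d + ñ) + 1) * (L : ℝ) ^ (2 * j)
                / (L : ℝ) ^ ((k - j) * (d - 1 + n)) ≤ (fourierCoeff (𝒞 A k) κ).re ∧
            ‖fourierCoeff (𝒞 A k) κ‖
              ≤ C * (L : ℝ) ^ (2 * (d + ñ) + 1) * (L : ℝ) ^ (2 * j)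
                  / (L : ℝ) ^ ((k - j) * (d - 1 + n))) ∧
          (k ≤ j →
            c / (L : ℝ) ^ (2 * (d + ñ) + 1) * (L : ℝ) ^ (2 * k)
                ≤ (fourierCoeff (𝒞 A k) κ).re ∧
            ‖fourierCoeff (𝒞 A k) κ‖ ≤ C * (L : ℝ) ^ (2 * k)) ∧
          ∀ B : Matrix (Fin d) (Fin d) ℝ, IsUnitSymm B → ∀ ℓ : ℕ, 1 ≤ ℓ →
            (j < k →
              ‖iteratedDeriv ℓ (fun s : ℝ => fourierCoeff (𝒞 (A + s • B) k) κ) 0‖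
                ≤ Cℓ ℓ * (L : ℝ) ^ (2 * (d + ñ) + 1) * (L : ℝ) ^ (2 * j)
                    / (L : ℝ) ^ ((k - j) * (d - 1 + ñ))) ∧
            (k ≤ j →
              ‖iteratedDeriv ℓ (fun s : ℝ => fourierCoeff (𝒞 (A + s • B) k) κ) 0‖
                ≤ Cℓ ℓ * (L : ℝ) ^ (2 * k))))
    (hB : AbkmWeightBounds L N Mord R n θbar lam μ δ₁ δ₀ A𝒫 (fun j => 𝒞 1 j)
      (abkmWeightData L N Mord R θbar (schedDelta δ₀ δ₁ N) fun j => 𝒞 1 j))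
    {k : ℕ} (hkN : k + 1 ≤ N) {pT r₀ : ℕ} (hpT : d / 2 + 2 ≤ pT) (hpM : pT + d ≤ Mord) (hr₀ : 3 ≤ r₀)
    {h A : ℝ} (hδ₀ : 0 < δ₀) (hδ₁ : 0 < δ₁) (hh : 0 < h) (hh0 : hZeroSq d R δ₀ δ₁ ≤ h ^ 2)
    (hA : 1 ≤ A) {ρ : ℝ} (hρ0 : 0 ≤ ρ) (hρ : ρ < θbar)
    {T₀ : ℝ} (hT₀ : T₀ ≤ 1 / 2) (hKT₀ : shellRatioConst c (Cℓ 1) (L : ℝ) d ñ * T₀ ≤ Real.log (1 + ρ))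
    {q q' : Matrix (Fin d) (Fin d) ℝ} (hq : q.IsSymm) (hq' : q'.IsSymm)
    (hqT : ∑ i, ∑ j, |q i j| ≤ T₀) (hq'T : ∑ i, ∑ j, |q' i j| ≤ T₀)
    {p qH ρ'' : ℝ} (hpq : p.HolderConjugate qH) (hρ''0 : 0 ≤ ρ'') (hρ'' : ρ'' < θbar)
    (hpρ : p * (1 + ρ) ≤ 1 + ρ'')
    -- large-set parameter at `κ' = 2^d A𝒫(ρ'')^{1/p}`
    (hκA : (2 : ℝ) ^ d * weightIntConstRho θbar ρ'' (traceConst d Mord R lam (derivSum d n fun θ' _ => Cα θ' 0)) ^ (1 / p) ≤ A)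
    {η : ℝ} (hη : 0 < η)
    (hsmall : (2 : ℝ) ^ (L ^ d) *
      ((2 : ℝ) ^ d * weightIntConstRho θbar ρ'' (traceConst d Mord R lam (derivSum d n fun θ' _ => Cα θ' 0)) ^ (1 / p) *
        A ^ (-(1 - η⁻¹) : ℝ)) ≤ 1)
    (hgain : ∀ X : Finset (Fin d → ZMod M), IsPolymer (L ^ k) X → IsConn X →
      2 ^ d < (blocks (L ^ k) X).card →
        η * ((blocks (L * L ^ k) (closure (L * L ^ k) X)).card : ℝ) ≤ (blocks (L ^ k) X).card)
    {K : Finset (Fin d → ZMod M) → ((Fin d → ZMod M) → ℝ) → ℂ} {C : ℝ} (hC : 0 ≤ C)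
    (hK : WeakNormLE (abkmNormParams L N Mord R pT r₀ h θbar A (schedDelta δ₀ δ₁ N) fun j => 𝒞 1 j) k K C)
    (hKt : TransInv (L ^ k) K) (hKd : ∀ X, ContDiff ℝ r₀ (K X))
    (hKloc : ∀ X, IsPolymer (L ^ k) X → IsConn X →
      IsGaugeLocal ((abkmNormParams L N Mord R pT r₀ h θbar A (schedDelta δ₀ δ₁ N) fun j => 𝒞 1 j).gauge k X)
        (K X))
    (hRa : ∀ X, ContDiff ℝ r₀ (fluct (𝒞 ((1 : Matrix (Fin d) (Fin d) ℝ) + q') (k + 1)) (K X)))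
    (hRb : ∀ X, ContDiff ℝ r₀ (fluct (𝒞 ((1 : Matrix (Fin d) (Fin d) ℝ) + q) (k + 1)) (K X))) :
    WeakNormLE (abkmNormParams L N Mord R pT r₀ h θbar A (schedDelta δ₀ δ₁ N) fun j => 𝒞 1 j) (k + 1)
      (opC (abkmStepData L R k fun j => 𝒞 ((1 : Matrix (Fin d) (Fin d) ℝ) + q') j) K -
        opC (abkmStepData L R k fun j => 𝒞 ((1 : Matrix (Fin d) (Fin d) ℝ) + q) j) K)
      (C * ((L : ℝ) ^ d *
        ((((r₀ + 1) * (8 * qH *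
            (Real.sqrt ((3 : ℝ) ^ (d + 1) * (((2 * ((2 * (2 ^ d + R) + 2 * pT + 1) + 1) : ℕ) : ℝ)) ^ d) *
              ((∑ i, ∑ j, |(q' - q) i j|) *
                Real.exp (2 * shellRatioConst c (Cℓ 1) (L : ℝ) d ñ * ∑ i, ∑ j, |(q' - q) i j|) *
                shellRatioConst c (Cℓ 1) (L : ℝ) d ñ)))) *
          ((2 : ℝ) ^ d * weightIntConstRho θbar ρ'' (traceConst d Mord R lam (derivSum d n fun θ' _ => Cα θ' 0)) ^ (1 / p))) *
            abkmContrConst d L R) +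
        ((r₀ + 1) * (8 * qH *
            (Real.sqrt ((3 : ℝ) ^ (d + 1) * (((2 * ((2 * (2 ^ d + R) + 2 * pT + 1) + 1) : ℕ) : ℝ)) ^ d) *
              ((∑ i, ∑ j, |(q' - q) i j|) *
                Real.exp (2 * shellRatioConst c (Cℓ 1) (L : ℝ) d ñ * ∑ i, ∑ j, |(q' - q) i j|) *
                shellRatioConst c (Cℓ 1) (L : ℝ) d ñ)))) *
          largePartEps d L A
            ((2 : ℝ) ^ d * weightIntConstRho θbar ρ'' (traceConst d Mord R lam (derivSum d n fun θ' _ => Cα θ' 0)) ^ (1 / p)) η)) := by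
  have h8 : 8 ≤ 2 ^ (d + 3) := by
    calc 8 = 2 ^ 3 := by norm_num
      _ ≤ 2 ^ (d + 3) := Nat.pow_le_pow_right (by norm_num) (by omega)
  have hL2 : 2 ≤ L := by omega
  have hk : k + 1 ≤ N + 1 := by omega
  have hp0 : 0 ≤ p := by linarith [hpq.lt]
  have hq2 : ∑ i, ∑ j, |q i j| ≤ 1 / 2 := hqT.trans hT₀
  have hq'2 : ∑ i, ∑ j, |q' i j| ≤ 1 / 2 := hq'T.trans hT₀
  have hellq : IsElliptic (1 / 2 : ℝ) 2 ((1 : Matrix (Fin d) (Fin d) ℝ) + q) :=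
    isElliptic_one_add_of_entrySum_le hq hq2
  have hellq' : IsElliptic (1 / 2 : ℝ) 2 ((1 : Matrix (Fin d) (Fin d) ℝ) + q') :=
    isElliptic_one_add_of_entrySum_le hq' hq'2
  set Da := abkmStepData L R k fun j => 𝒞 ((1 : Matrix (Fin d) (Fin d) ℝ) + q') j with hDa
  set Db := abkmStepData L R k fun j => 𝒞 ((1 : Matrix (Fin d) (Fin d) ℝ) + q) j with hDb
  have hDa𝒞 : Da.𝒞 = 𝒞 ((1 : Matrix (Fin d) (Fin d) ℝ) + q') (k + 1) := rfl
  have hDb𝒞 : Db.𝒞 = 𝒞 ((1 : Matrix (Fin d) (Fin d) ℝ) + q) (k + 1) := rfl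
  have hSa : StepKernelBounds (abkmWeightData L N Mord R θbar (schedDelta δ₀ δ₁ N) fun j => 𝒞 1 j) L k _ _ Da.𝒞 :=
    stepKernelBounds_one_add_of_torusFRD hd hMord hMR hLodd hL hθbar hlam hn hn2 hnñ hc hC1 hallA hB hk
      hρ0 hρ hT₀ hKT₀ hq' hq'T
  have hSb : StepKernelBounds (abkmWeightData L N Mord R θbar (schedDelta δ₀ δ₁ N) fun j => 𝒞 1 j) L k _ _ Db.𝒞 :=
    stepKernelBounds_one_add_of_torusFRD hd hMord hMR hLodd hL hθbar hlam hn hn2 hnñ hc hC1 hallA hB hk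
      hρ0 hρ hT₀ hKT₀ hq hqT
  have hA𝒫p : 0 ≤ weightIntConstRho θbar ρ'' (traceConst d Mord R lam (derivSum d n fun θ' _ => Cα θ' 0)) :=
    zero_le_one.trans (one_le_weightIntConstRho hθbar hρ''0 hρ''
      (traceConst_nonneg d Mord R hlam.le (derivSum_nonneg d n _)))
  have hq0 : 0 < qH := by linarith [hpq.symm.lt]
  have hκ0 : 0 ≤ weightIntConstRho θbar ρ'' (traceConst d Mord R lam (derivSum d n fun θ' _ => Cα θ' 0)) ^ (1 / p) :=
    Real.rpow_nonneg hA𝒫p _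
  set κ := weightIntConstRho θbar ρ'' (traceConst d Mord R lam (derivSum d n fun θ' _ => Cα θ' 0)) ^ (1 / p) with hκdef
  have hκ'0 : 0 ≤ (2 : ℝ) ^ d * κ := by positivity
  set c₁ : ℕ := 2 * (2 ^ d + R) + 2 * pT + 1 with hc₁
  set EK := (∑ i, ∑ j, |(q' - q) i j|) *
      Real.exp (2 * shellRatioConst c (Cℓ 1) (L : ℝ) d ñ * ∑ i, ∑ j, |(q' - q) i j|) *
      shellRatioConst c (Cℓ 1) (L : ℝ) d ñ with hEK
  have hK0' : 0 ≤ shellRatioConst c (Cℓ 1) (L : ℝ) d ñ := shellRatioConst_nonneg hc hC1 (Nat.cast_nonneg _) d ñ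
  have hT0 : 0 ≤ ∑ i, ∑ j, |(q' - q) i j| := sum_nonneg fun _ _ => sum_nonneg fun _ _ => abs_nonneg _
  have hEK0 : 0 ≤ EK := by positivity
  have hℓ : 0 ≤ (r₀ + 1) * (8 * qH * (Real.sqrt ((3 : ℝ) ^ (d + 1) * (((2 * (c₁ + 1) : ℕ) : ℝ)) ^ d) * EK)) := by
    positivity
  refine weakNormLE_opC_sub_abkm_of_stepKernelBounds hd hLodd hL hM hkN hpT hpM hMR hr₀ hB hδ₀ hδ₁ hh hh0 hκ'0 hA
    hκA hη hsmall hgain Da Db rfl rfl hSa hSb rfl rfl rfl rfl (x₀ := 0) rfl rfl hℓ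
    (fun X hX hXc F C0 hC0 hFd hFloc hF => ?_) hC hK hKt hKd hKloc hRa hRb
  -- the pair property on connected polymers, polynomial factor absorbed into `κ' = 2^d κ`
  have hconn := tayNormLE_fluct_sub_fluct_conn_of_torusFRD hd hMord hMR hLodd hL hM hθbar hlam hn hn2 hnñ hgap hc hC1
    hallA hB hkN hρ0 hρ hT₀ hKT₀ hq hq' hqT hq'T hpq hρ''0 hρ'' hpρ hX hXc hC0 hFd hFloc hF
    (pT := pT) (r₀ := r₀) (h := h) (A := A)
  refine hconn.mono ?_ (fun φ => ((abkmWeightData L N Mord R θbar (schedDelta δ₀ δ₁ N) fun j => 𝒞 1 j).midWeight_pos k X φ).le)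
  set m := numBlocks (L ^ k) X with hm
  have hsq := sqrt_polymerFactor_le d m c₁
  have hmc : 2 * (m + 2 * (2 ^ d + R) + 2 * pT + 1) = 2 * (m + c₁) := by rw [hc₁]; ring
  rw [hmc]
  calc C0 * ((r₀ + 1) * (8 * qH * (Real.sqrt ((3 : ℝ) ^ (d + 1) * (((2 * (m + c₁) : ℕ) : ℝ)) ^ d) * EK))) * κ ^ m
      ≤ C0 * ((r₀ + 1) * (8 * qH *
          (Real.sqrt ((3 : ℝ) ^ (d + 1) * (((2 * (c₁ + 1) : ℕ) : ℝ)) ^ d) * ((2 : ℝ) ^ d) ^ m * EK))) * κ ^ m := by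
        have : Real.sqrt ((3 : ℝ) ^ (d + 1) * (((2 * (m + c₁) : ℕ) : ℝ)) ^ d) * EK ≤
            Real.sqrt ((3 : ℝ) ^ (d + 1) * (((2 * (c₁ + 1) : ℕ) : ℝ)) ^ d) * ((2 : ℝ) ^ d) ^ m * EK :=
          mul_le_mul_of_nonneg_right hsq hEK0
        gcongr
    _ = C0 * ((r₀ + 1) * (8 * qH * (Real.sqrt ((3 : ℝ) ^ (d + 1) * (((2 * (c₁ + 1) : ℕ) : ℝ)) ^ d) * EK))) *
          ((2 : ℝ) ^ d * κ) ^ m := by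
        rw [mul_pow]; ring

end Package

end Literature.MathematicalPhysics.StatisticalMechanics.GradientRG

end
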